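import Summits.MatrixMultiplication.MatrixMultiplication.Theorems.SoloInformedValConjecture

/-!
# SoloInformedValLocalDegree — the local degree inequality for equilateral trapezoid-free triples

K. Pratt, *On generalized corners and matrix multiplication*, arXiv:2309.03878, Def. 3.2 / Prop. 3.1 / Prop. 3.4.
For an equilateral trapezoid-free triple `(A, B, C)` with target `t` in an additive commutative group `G`
(`TrapezoidFreeG` of `SoloInformedValConjecture`) write `N_C(a) = {c ∈ C : t - a - c ∈ B}` (`nbhdC`, the
solutions through `a`) and `deg c = #{a ∈ A : t - a - c ∈ B}` (`degC`, the solutions through `c`).  We prove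

* `sum_degC_nbhdC_le` (★): for every `a ∈ A`, `∑_{c ∈ N_C(a)} deg c ≤ #B` — the pointwise form of the first
  trapezoid condition (it is that condition summed over `b' ∈ B`);
* `card_solutionsG_eq_sum_card_nbhdC` / `card_solutionsG_eq_sum_degC`: `#solutions = ∑_{a ∈ A} #N_C(a) = ∑_{c ∈ C} deg c`;
* `sum_degC_sq_le`: `∑_{c ∈ C} (deg c)^2 ≤ #A · #B` — the inequality behind [Pratt, Prop. 3.1], obtained by
  summing (★) over `a ∈ A`; and `card_solutionsG_sq_le`: `#solutions ^ 2 ≤ #C · (#A · #B)` ([Pratt, Prop. 3.1 /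
  the upper bound of Prop. 3.4] for parts of arbitrary sizes);
* `card_solutionsG_mul_le_of_le_degC`: if every `c ∈ C` lying on a solution has `deg c ≥ d`, then
  `#solutions · d ≤ #A · #B`.

The last item is the "generic-degree obstruction" of the seat's dossier (§14): if the positive degrees are at
least `λ · #A · #B / |G|` — the count predicted by the densities — then `#solutions ≤ |G| / λ`; a superlinear value
of `Val` forces vertices whose degree is polynomially deficient relative to density.

solo-informed MatrixMultiplication, gen 70.
-/

namespace Summit.MatrixMultiplication.MatrixMultiplication.Theorems.SoloVal

open Finset

section LocalDegree

variable {G : Type*} [AddCommGroup G] [DecidableEq G]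

/-- The `C`-neighbourhood of `a`: those `c ∈ C` with `(a, t - a - c, c)` a solution. -/
def nbhdC (B C : Finset G) (t a : G) : Finset G := C.filter (fun c => t - a - c ∈ B)

/-- The degree of `c`: the number of `a ∈ A` with `(a, t - a - c, c)` a solution. -/
def degC (A B : Finset G) (t c : G) : ℕ := (A.filter (fun a => t - a - c ∈ B)).card

/-- Membership in the `C`-neighbourhood of `a`. -/
theorem mem_nbhdC {B C : Finset G} {t a c : G} : c ∈ nbhdC B C t a ↔ c ∈ C ∧ t - a - c ∈ B := by
  simp [nbhdC]

/-- A `c` lying on a solution through some `a ∈ A` has positive degree. -/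
theorem degC_pos_of_mem_nbhdC {A B C : Finset G} {t a c : G} (ha : a ∈ A) (hc : c ∈ nbhdC B C t a) :
    0 < degC A B t c := by
  rw [degC, card_pos]
  exact ⟨a, mem_filter.2 ⟨ha, (mem_nbhdC.1 hc).2⟩⟩

/-- (★) The local degree inequality: for `a ∈ A`, the total degree of the `C`-neighbourhood of `a` is at most
`#B`.  Proof: `(c, a₂) ↦ t - a₂ - c` maps the pairs `c ∈ N_C(a)`, `a₂ ∈ A`, `t - a₂ - c ∈ B` injectively into
`B`, injectivity being exactly the first system of [Pratt, Def. 3.2] with `a' = a`, `b' = t - a₂ - c`. -/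
theorem sum_degC_nbhdC_le {A B C : Finset G} {t : G} (h : TrapezoidFreeG A B C t) {a : G} (ha : a ∈ A) :
    ∑ c ∈ nbhdC B C t a, degC A B t c ≤ B.card := by
  have hsum : ∑ c ∈ nbhdC B C t a, degC A B t c =
      ((nbhdC B C t a).sigma (fun c => A.filter (fun a₂ => t - a₂ - c ∈ B))).card := by
    rw [card_sigma]; rfl
  rw [hsum]
  refine card_le_card_of_injOn (fun p => t - p.2 - p.1) ?_ ?_
  · intro p hp
    have hp' := mem_sigma.1 (mem_coe.1 hp)
    exact mem_coe.2 (mem_filter.1 hp'.2).2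
  · intro p hp p' hp' he
    have h1 := mem_sigma.1 (mem_coe.1 hp)
    have h2 := mem_sigma.1 (mem_coe.1 hp')
    obtain ⟨hc, hcB⟩ := mem_nbhdC.1 h1.1
    obtain ⟨hc', hcB'⟩ := mem_nbhdC.1 h2.1
    obtain ⟨ha₂, ha₂B⟩ := mem_filter.1 h1.2
    obtain ⟨ha₂', ha₂B'⟩ := mem_filter.1 h2.2
    simp only at he
    -- first trapezoid condition with a' = a, b' = t - p.2 - p.1, c₁ = p.1, c₂ = p'.1
    have key : p.1 = p'.1 := by
      refine h.1 a ha (t - p.2 - p.1) ha₂B p.1 hc p'.1 hc' hcB ?_ hcB' ?_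
      · have : t - (t - p.2 - p.1) - p.1 = p.2 := by abel
        rw [this]; exact ha₂
      · have : t - (t - p.2 - p.1) - p'.1 = p'.2 := by
          rw [he]; abel
        rw [this]; exact ha₂'
    have key2 : p.2 = p'.2 := by
      have e1 : p.2 = t - p.1 - (t - p.2 - p.1) := by abel
      have e2 : p'.2 = t - p'.1 - (t - p'.2 - p'.1) := by abel
      rw [e1, e2, he, key]
    exact Sigma.ext key (heq_of_eq key2)

/-- `#solutions = ∑_{a ∈ A} #N_C(a)`. -/
theorem card_solutionsG_eq_sum_card_nbhdC (A B C : Finset G) (t : G) :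
    (solutionsG A B C t).card = ∑ a ∈ A, (nbhdC B C t a).card := by
  rw [← card_sigma]
  symm
  refine card_nbij' (fun p => (p.1, t - p.1 - p.2, p.2)) (fun q => ⟨q.1, q.2.2⟩) ?_ ?_ ?_ ?_
  · intro p hp
    have h1 := mem_sigma.1 (mem_coe.1 hp)
    obtain ⟨hc, hcB⟩ := mem_nbhdC.1 h1.2
    refine mem_coe.2 (mem_filter.2 ⟨?_, ?_⟩)
    · simp only [mem_product]; exact ⟨h1.1, hcB, hc⟩
    · simp only; abel
  · intro q hq
    obtain ⟨hq1, hq2⟩ := mem_filter.1 (mem_coe.1 hq)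
    simp only [mem_product] at hq1
    refine mem_coe.2 (mem_sigma.2 ⟨hq1.1, mem_nbhdC.2 ⟨hq1.2.2, ?_⟩⟩)
    have : t - q.1 - q.2.2 = q.2.1 := by rw [← hq2]; abel
    rw [this]; exact hq1.2.1
  · intro p hp
    rfl
  · intro q hq
    obtain ⟨hq1, hq2⟩ := mem_filter.1 (mem_coe.1 hq)
    have : t - q.1 - q.2.2 = q.2.1 := by rw [← hq2]; abel
    simp only [this]

/-- `#solutions = ∑_{c ∈ C} deg c`. -/
theorem card_solutionsG_eq_sum_degC (A B C : Finset G) (t : G) :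
    (solutionsG A B C t).card = ∑ c ∈ C, degC A B t c := by
  unfold degC
  rw [← card_sigma]
  symm
  refine card_nbij' (fun p => (p.2, t - p.2 - p.1, p.1)) (fun q => ⟨q.2.2, q.1⟩) ?_ ?_ ?_ ?_
  · intro p hp
    have h1 := mem_sigma.1 (mem_coe.1 hp)
    obtain ⟨ha, haB⟩ := mem_filter.1 h1.2
    refine mem_coe.2 (mem_filter.2 ⟨?_, ?_⟩)
    · simp only [mem_product]; exact ⟨ha, haB, h1.1⟩
    · simp only; abel
  · intro q hq
    obtain ⟨hq1, hq2⟩ := mem_filter.1 (mem_coe.1 hq)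
    simp only [mem_product] at hq1
    refine mem_coe.2 (mem_sigma.2 ⟨hq1.2.2, mem_filter.2 ⟨hq1.1, ?_⟩⟩)
    have : t - q.1 - q.2.2 = q.2.1 := by rw [← hq2]; abel
    rw [this]; exact hq1.2.1
  · intro p hp
    rfl
  · intro q hq
    obtain ⟨hq1, hq2⟩ := mem_filter.1 (mem_coe.1 hq)
    have : t - q.1 - q.2.2 = q.2.1 := by rw [← hq2]; abel
    simp only [this]

/-- Summing (★) over `a ∈ A`: `∑_{c ∈ C} (deg c)^2 ≤ #A · #B` — the inequality in the proof of [Pratt, Prop. 3.1]. -/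
theorem sum_degC_sq_le {A B C : Finset G} {t : G} (h : TrapezoidFreeG A B C t) :
    ∑ c ∈ C, degC A B t c ^ 2 ≤ A.card * B.card := by
  have step1 : ∑ c ∈ C, degC A B t c ^ 2 =
      ∑ c ∈ C, ∑ a ∈ A.filter (fun a => t - a - c ∈ B), degC A B t c := by
    refine sum_congr rfl (fun c _ => ?_)
    rw [sum_const, smul_eq_mul, sq]; rfl
  have step2 : ∑ c ∈ C, ∑ a ∈ A.filter (fun a => t - a - c ∈ B), degC A B t c =
      ∑ a ∈ A, ∑ c ∈ nbhdC B C t a, degC A B t c := by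
    unfold nbhdC
    simp only [sum_filter]
    rw [sum_comm]
  rw [step1, step2]
  calc ∑ a ∈ A, ∑ c ∈ nbhdC B C t a, degC A B t c ≤ ∑ a ∈ A, B.card :=
        sum_le_sum (fun a ha => sum_degC_nbhdC_le h ha)
    _ = A.card * B.card := by rw [sum_const, smul_eq_mul]

/-- [Pratt, Prop. 3.1 / Prop. 3.4 upper bound] with parts of arbitrary sizes: `#solutions² ≤ #C · #A · #B`
(so `Val(G) ≤ |G|^{3/2}`). -/
theorem card_solutionsG_sq_le {A B C : Finset G} {t : G} (h : TrapezoidFreeG A B C t) :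
    (solutionsG A B C t).card ^ 2 ≤ C.card * (A.card * B.card) := by
  rw [card_solutionsG_eq_sum_degC]
  have cs := sum_mul_sq_le_sq_mul_sq C (fun c => degC A B t c) (fun _ => (1 : ℕ))
  simp only [mul_one, one_pow, sum_const, smul_eq_mul] at cs
  calc (∑ c ∈ C, degC A B t c) ^ 2 ≤ (∑ c ∈ C, degC A B t c ^ 2) * C.card := cs
    _ ≤ (A.card * B.card) * C.card := Nat.mul_le_mul_right _ (sum_degC_sq_le h)
    _ = C.card * (A.card * B.card) := by ring

/-- The generic-degree obstruction: if every `c ∈ C` that lies on a solution has `deg c ≥ d`, then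
`#solutions · d ≤ #A · #B`.  (With `d ≥ λ · #A·#B/|G|`, the density prediction, this reads `#solutions ≤ |G|/λ`:
superlinear `Val` needs degrees polynomially below the density prediction.) -/
theorem card_solutionsG_mul_le_of_le_degC {A B C : Finset G} {t : G} (h : TrapezoidFreeG A B C t) (d : ℕ)
    (hd : ∀ c ∈ C, 0 < degC A B t c → d ≤ degC A B t c) :
    (solutionsG A B C t).card * d ≤ A.card * B.card := by
  rw [card_solutionsG_eq_sum_card_nbhdC, sum_mul]
  calc ∑ a ∈ A, (nbhdC B C t a).card * d = ∑ a ∈ A, ∑ c ∈ nbhdC B C t a, d := by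
        refine sum_congr rfl (fun a _ => ?_); rw [sum_const, smul_eq_mul]
    _ ≤ ∑ a ∈ A, ∑ c ∈ nbhdC B C t a, degC A B t c := by
        refine sum_le_sum (fun a ha => sum_le_sum (fun c hc => ?_))
        exact hd c (mem_nbhdC.1 hc).1 (degC_pos_of_mem_nbhdC ha hc)
    _ ≤ ∑ a ∈ A, B.card := sum_le_sum (fun a ha => sum_degC_nbhdC_le h ha)
    _ = A.card * B.card := by rw [sum_const, smul_eq_mul]

end LocalDegree

end Summit.MatrixMultiplication.MatrixMultiplication.Theorems.SoloVal
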